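import Summits.NavierStokesRegularity.NavierStokesRegularity.Theorems.CertifiedBlowupCertifiedBlowupVorticityRateBlowupConstantFloor
import HarnessLib

/-!
# Certificate class `CertifiedBlowupVorticityRateBlowup` (stmt-NavierStokesRegularity-8639): THE FLOOR OF THE CERTIFICATE
# CONSTANT IS `1/(2κ)` FOR ANY ENSTROPHY SLAB-GRÖNWALL COEFFICIENT `κ` — the floor chain of deposit 6, parametrically

Theorems file landed `--supports stmt-NavierStokesRegularity-8639` (cell `ns-blowup`, GROUP B zone Z1 → the certificate
crux; ninth crux-side deposit of the zone-Z1 seat, lead letter (ls)). Deposit 6 (`…VorticityRateBlowupConstantFloor`,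
namespace `…ConstantFloor`) proved `C ≥ 1/4` for every witness `(ν, T, u, p)` of the certificate class and every `C` with
`(T − t)‖curl u(t)‖_∞ ≤ C` near `T⁻`, from the enstrophy slab Grönwall `∫|ω(t₂)|² ≤ ∫|ω(t₁)|²·exp(2Ω(t₂ − t₁))` under
`|ω| ≤ Ω` on `[t₁, t₂]` (RRS 2016 (12.12), tree p550635) and Leray's enstrophy rate. The only place the constant `2` of
(12.11) enters is that slab inequality. This file re-runs the chain with the slab coefficient as a PARAMETER `κ > 0`:

  SLAB HYPOTHESIS `(S_κ)` for `u` on `[0, T)` (spelled out in every statement; no definition is introduced):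
  for all `0 ≤ t₁ < t₂ < T` and `Ω` with `‖curl u(t, x)‖ ≤ Ω` on `[t₁, t₂] × ℝ³`,
  `∫|curl u(t₂)|² ≤ (∫|curl u(t₁)|²) · exp(κ Ω (t₂ − t₁))`.

* `slab_gronwall_two` — `(S_2)` HOLDS for every classical unforced solution on `[0, T) × ℝ³`, `ν > 0`, in the
  Beale–Kato–Majda class on every `[0, T'']`, `T'' < T` (the tree's `integral_sq_norm_curl_le_mul_exp_of_norm_curl_le`,
  time-translated) — the instance of record; the STRAIN instance `κ = 2/√3` (`ω·∇u·ω = ω·Sω`, `tr S = 0`,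
  `∫|S|² = ½∫|∇u|²`) is the Literature file `VorticitySupEnstrophyGronwallSharp` (cell writer ecbridge-8) and is
  instantiated in the closing file `…ConstantFloorSharp`;
* `integral_sq_norm_curl_geometric_of_slab` — under `(S_κ)` and the rate `(T − t)‖curl u(t, x)‖ ≤ C` on `[t₀, T)`:
  `∫|ω(tₙ)|² ≤ ∫|ω(t₀)|² · exp(κC(q − 1))ⁿ` along `tₙ = T − (T − t₀)q^{−n}`, `q > 1`;
* `log_le_of_slab` — against Leray's `cν^{3/2}/√(T − t) ≤ ∫|ω(t)|²` (deposit 6's `leray_le_integral_sq_norm_curl`, by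
  name): `log q ≤ 2κC(q − 1)` for every `q > 1`;
* `inv_two_mul_le_of_slab` — **THE FLOOR `1/(2κ) ≤ C`**;
* `vorticityRate_witness_const_ge_of_slab`, `vorticityRate_witness_frequently_gt_of_slab` — assembled for the witnesses
  of the certificate class: `(S_κ)` ⇒ `C ≥ 1/(2κ)`, equivalently `limsup (T − t)‖ω(t)‖_∞ ≥ 1/(2κ)`;
* `vorticityRateExclusion_below_of_slab` — crux #4's text `CertifiedBlowupVorticityRateExclusion` with the slab
  hypothesis `(S_κ)` added and `∀ C` replaced by `∀ C < 1/(2κ)`, verbatim otherwise;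
* the `κ = 2` INSTANCE reproduces deposit 6 (`quarter_le_of_vorticityRate`, `vorticityRateExclusion_below_quarter`):
  checked below by `example`s closing with deposit 6's statements verbatim (`1/(2·2) = 1/4`).

READING: any kernel slab constant `κ` gives the floor `C_ω ≥ 1/(2κ)` (quantitative BKM:
`∫‖ω‖_∞ ≥ (1/(2κ)) log(1/(T − t)) − K`); tree `κ = 2` ⇒ `1/4`; strain `κ = 2/√3` ⇒ `√3/4 ≈ 0.433`. No new definitions,
no named-fact hypotheses, no `sorry`. WHAT THIS IS NOT: not a blow-up or regularity claim — a priori inequalities about a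
HYPOTHETICAL witness of the certificate class; crux 8639, crux 8640 and (AX-L) are untouched. Author:
ns-blowup-profile-eng-1 g12, 2026-08-27.

## References
* J. C. Robinson, J. L. Rodrigo, W. Sadowski, *The Three-Dimensional Navier–Stokes Equations*, CUP 2016, Thm 12.3
  (12.11)–(12.12). [RobinsonRodrigoSadowski2016]
* J. Leray, Acta Math. 63 (1934), §20 (3.12). [Leray1934]
* D. Chae, Comm. Math. Phys. 263 (2005), Thm 2.2 (`λ_max(S)² ≤ ⅔|S|²`). [Chae2005]
-/

-- the summit and its single problem share the name (D-0017 nested layout)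
set_option linter.dupNamespace false

noncomputable section

open MeasureTheory Set Function Filter Topology Metric
open scoped ENNReal NNReal RealInnerProductSpace

namespace Summit.NavierStokesRegularity.NavierStokesRegularity.Theorems.CertifiedBlowupVorticityRateBlowup.SlabFloor

open Literature.Analysis.FluidPDE
open Summit.NavierStokesRegularity.NavierStokesRegularity.Theorems.CertifiedBlowupAxisymBlowup.CompactAmplification
open Summit.NavierStokesRegularity.NavierStokesRegularity.Theorems.CertifiedBlowupVorticityRateBlowup.ConstantFloor

variable {ν T : ℝ} {u : ℝ → EuclideanSpace ℝ (Fin 3) → EuclideanSpace ℝ (Fin 3)}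
  {p : ℝ → EuclideanSpace ℝ (Fin 3) → ℝ}

/-! ### The instance of record: `κ = 2` -/

/-- **`(S_2)` holds for classical solutions.** Let `(u, p)` be a classical unforced solution on `[0, T) × ℝ³`, `ν > 0`, in
the Beale–Kato–Majda class on every `[0, T'']`, `T'' < T`. Then for all `0 ≤ t₁ < t₂ < T` and `Ω` with
`‖curl u(t, x)‖ ≤ Ω` on `[t₁, t₂] × ℝ³`: `∫|curl u(t₂)|² ≤ (∫|curl u(t₁)|²) · exp(2Ω(t₂ − t₁))` — the tree's RRS (12.12)
slab bound `integral_sq_norm_curl_le_mul_exp_of_norm_curl_le` for the translate `u(· + t₁)` on `[0, t₂ − t₁]`.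
[cite: RobinsonRodrigoSadowski2016, Thm 12.3 (12.12)] -/
theorem slab_gronwall_two (hν : 0 < ν) (hcl : IsClassicalNSSolutionOn (Ico 0 T) ν 0 u p)
    (hreg : ∀ T'' < T, HasBoundedSobolevNormsOn (Icc 0 T'') u) :
    ∀ ⦃t₁ t₂ Ω : ℝ⦄, 0 ≤ t₁ → t₁ < t₂ → t₂ < T → (∀ t ∈ Icc t₁ t₂, ∀ x, ‖curl (u t) x‖ ≤ Ω) →
      ∫ x, ‖curl (u t₂) x‖ ^ 2 ≤ (∫ x, ‖curl (u t₁) x‖ ^ 2) * Real.exp (2 * Ω * (t₂ - t₁)) := by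
  intro t₁ t₂ Ω ht₁ h12 ht₂ hω
  set v : ℝ → EuclideanSpace ℝ (Fin 3) → EuclideanSpace ℝ (Fin 3) := fun s => u (s + t₁) with hv
  have hd : 0 < t₂ - t₁ := sub_pos.2 h12
  have hS : IsClassicalNSSolutionOn (Icc 0 (t₂ - t₁)) ν 0 v (fun s => p (s + t₁)) :=
    (hcl.translate_Ico_zero ht₁).mono (Icc_subset_Ico_right (by linarith)) (uniqueDiffOn_Icc hd)
  have hB : HasBoundedSobolevNormsOn (Icc 0 (t₂ - t₁)) v := fun n => by
    obtain ⟨Cn, hCn⟩ := hreg t₂ ht₂ n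
    exact ⟨Cn, fun s hs => hCn (s + t₁) ⟨by linarith [hs.1], by linarith [hs.2]⟩⟩
  have hΩ : ∀ s ∈ Icc 0 (t₂ - t₁), ∀ x, ‖curl (v s) x‖ ≤ Ω := fun s hs x =>
    hω (s + t₁) ⟨by linarith [hs.1], by linarith [hs.2]⟩ x
  have h := integral_sq_norm_curl_le_mul_exp_of_norm_curl_le hν hd hS hB hΩ (t₂ - t₁) ⟨hd.le, le_rfl⟩
  simpa only [hv, sub_add_cancel, zero_add] using h

/-! ### Geometric slabs under `(S_κ)` -/

/-- **Geometric slabs under `(S_κ)`.** If `u` obeys the slab Grönwall `(S_κ)` on `[0, T)` and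
`(T − t)‖curl u(t, x)‖ ≤ C` on `[t₀, T) × ℝ³` (`0 ≤ t₀ < T`), then for every `q > 1` and `n ∈ ℕ`:
`∫|curl u(tₙ)|² ≤ (∫|curl u(t₀)|²) · exp(κC(q − 1))ⁿ`, `tₙ = T − (T − t₀)/qⁿ` — on `[tₙ, tₙ₊₁]` the vorticity is at most
`C/(T − tₙ₊₁)` and `κ (C/(T − tₙ₊₁)) (tₙ₊₁ − tₙ) = κC(q − 1)`. [new here — elementary] -/
theorem integral_sq_norm_curl_geometric_of_slab {κ : ℝ}
    (hslab : ∀ ⦃t₁ t₂ Ω : ℝ⦄, 0 ≤ t₁ → t₁ < t₂ → t₂ < T → (∀ t ∈ Icc t₁ t₂, ∀ x, ‖curl (u t) x‖ ≤ Ω) →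
      ∫ x, ‖curl (u t₂) x‖ ^ 2 ≤ (∫ x, ‖curl (u t₁) x‖ ^ 2) * Real.exp (κ * Ω * (t₂ - t₁)))
    {C t₀ : ℝ} (ht₀ : 0 ≤ t₀) (ht₀T : t₀ < T)
    (hω : ∀ t ∈ Ico t₀ T, ∀ x, (T - t) * ‖curl (u t) x‖ ≤ C) {q : ℝ} (hq : 1 < q) (n : ℕ) :
    ∫ x, ‖curl (u (T - (T - t₀) / q ^ n)) x‖ ^ 2 ≤
      (∫ x, ‖curl (u t₀) x‖ ^ 2) * Real.exp (κ * C * (q - 1)) ^ n := by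
  set a : ℝ := T - t₀ with ha
  have ha0 : 0 < a := sub_pos.2 ht₀T
  have hq0 : 0 < q := by linarith
  induction n with
  | zero => simp [ha]
  | succ n ih =>
    have hqn : 0 < q ^ n := pow_pos hq0 n
    have hqn1 : 0 < q ^ (n + 1) := pow_pos hq0 (n + 1)
    have h1qn : 1 ≤ q ^ n := one_le_pow₀ hq.le
    have hlt : a / q ^ (n + 1) < a / q ^ n := by
      rw [div_lt_div_iff_of_pos_left ha0 hqn1 hqn, pow_succ]
      exact lt_mul_of_one_lt_right hqn hq
    have hle : a / q ^ n ≤ a := div_le_self ha0.le h1qn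
    have hpos : 0 < a / q ^ (n + 1) := div_pos ha0 hqn1
    have ht₁ : 0 ≤ T - a / q ^ n := by linarith
    have h12 : T - a / q ^ n < T - a / q ^ (n + 1) := by linarith
    have ht₂ : T - a / q ^ (n + 1) < T := by linarith
    have hωslab : ∀ t ∈ Icc (T - a / q ^ n) (T - a / q ^ (n + 1)), ∀ x,
        ‖curl (u t) x‖ ≤ C / (T - (T - a / q ^ (n + 1))) := by
      intro t ht x
      have htI : t ∈ Ico t₀ T := ⟨by linarith [ht.1], by linarith [ht.2]⟩
      have h := hω t htI x
      rw [le_div_iff₀ (by linarith : 0 < T - (T - a / q ^ (n + 1)))]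
      calc ‖curl (u t) x‖ * (T - (T - a / q ^ (n + 1))) ≤ ‖curl (u t) x‖ * (T - t) :=
            mul_le_mul_of_nonneg_left (by linarith [ht.2]) (norm_nonneg _)
        _ = (T - t) * ‖curl (u t) x‖ := mul_comm _ _
        _ ≤ C := h
    have hstep := hslab ht₁ h12 ht₂ hωslab
    have ha' : a ≠ 0 := ha0.ne'
    have hq' : q ≠ 0 := hq0.ne'
    have hexp : κ * (C / (T - (T - a / q ^ (n + 1)))) * (T - a / q ^ (n + 1) - (T - a / q ^ n)) =
        κ * C * (q - 1) := by
      rw [sub_sub_cancel]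
      field_simp
      ring
    rw [hexp] at hstep
    calc ∫ x, ‖curl (u (T - a / q ^ (n + 1))) x‖ ^ 2
        ≤ (∫ x, ‖curl (u (T - a / q ^ n)) x‖ ^ 2) * Real.exp (κ * C * (q - 1)) := hstep
      _ ≤ (∫ x, ‖curl (u t₀) x‖ ^ 2) * Real.exp (κ * C * (q - 1)) ^ n * Real.exp (κ * C * (q - 1)) :=
          mul_le_mul_of_nonneg_right ih (Real.exp_nonneg _)
      _ = (∫ x, ‖curl (u t₀) x‖ ^ 2) * Real.exp (κ * C * (q - 1)) ^ (n + 1) := by rw [pow_succ]; ring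

/-! ### The floor `1/(2κ)` -/

/-- **`log q ≤ 2κC(q − 1)` for every `q > 1`.** For a witness of the crux obeying `(S_κ)` with
`(T − t)‖curl u(t, x)‖ ≤ C` on `[t₀, T) × ℝ³`: along `tₙ = T − (T − t₀)q^{−n}`, Leray gives
`cν^{3/2}√qⁿ/√(T − t₀) ≤ ∫|ω(tₙ)|²` (`leray_le_integral_sq_norm_curl`) and the geometric Grönwall gives
`∫|ω(tₙ)|² ≤ ∫|ω(t₀)|² exp(κC(q − 1))ⁿ`; so `(√q/exp(κC(q−1)))ⁿ` is bounded, whence `√q ≤ exp(κC(q − 1))`.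
[new here — elementary] -/
theorem log_le_of_slab (hν : 0 < ν) (hT : 0 < T) (hmax : IsMaximalSmoothSolution ν 0 u p T)
    (hLH : IsLerayHopfOn T ν 0 (u 0) u) (hdec : HasRapidSpatialDecay (u 0)) (haxi : IsAxisymmetric (u 0))
    {κ : ℝ}
    (hslab : ∀ ⦃t₁ t₂ Ω : ℝ⦄, 0 ≤ t₁ → t₁ < t₂ → t₂ < T → (∀ t ∈ Icc t₁ t₂, ∀ x, ‖curl (u t) x‖ ≤ Ω) →
      ∫ x, ‖curl (u t₂) x‖ ^ 2 ≤ (∫ x, ‖curl (u t₁) x‖ ^ 2) * Real.exp (κ * Ω * (t₂ - t₁)))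
    {C t₀ : ℝ} (ht₀ : 0 ≤ t₀) (ht₀T : t₀ < T) (hω : ∀ t ∈ Ico t₀ T, ∀ x, (T - t) * ‖curl (u t) x‖ ≤ C)
    {q : ℝ} (hq : 1 < q) : Real.log q ≤ 2 * κ * C * (q - 1) := by
  obtain ⟨c, hc, hler⟩ := leray_le_integral_sq_norm_curl
  set a : ℝ := T - t₀ with ha
  have ha0 : 0 < a := sub_pos.2 ht₀T
  have hq0 : 0 < q := by linarith
  set E₀ : ℝ := ∫ x, ‖curl (u t₀) x‖ ^ 2 with hE₀
  set r : ℝ := Real.exp (κ * C * (q - 1)) with hr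
  have hr0 : 0 < r := Real.exp_pos _
  set L : ℝ := c * ν ^ (3 / 2 : ℝ) / Real.sqrt a with hL
  have hL0 : 0 < L := div_pos (mul_pos hc (Real.rpow_pos_of_pos hν _)) (Real.sqrt_pos.2 ha0)
  have hbound : ∀ n : ℕ, L * Real.sqrt q ^ n ≤ E₀ * r ^ n := by
    intro n
    have hqn : 0 < q ^ n := pow_pos hq0 n
    have htn : T - a / q ^ n ∈ Ico 0 T := by
      refine ⟨?_, by linarith [div_pos ha0 hqn]⟩
      have : a / q ^ n ≤ a := div_le_self ha0.le (one_le_pow₀ hq.le)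
      linarith
    have h1 := hler hν hT hmax hLH hdec haxi _ htn
    have h2 := integral_sq_norm_curl_geometric_of_slab hslab ht₀ ht₀T hω hq n
    have hsq : Real.sqrt (T - (T - a / q ^ n)) = Real.sqrt a / Real.sqrt q ^ n := by
      rw [sub_sub_cancel, Real.sqrt_div' a (le_of_lt hqn)]
      congr 1
      rw [show q ^ n = (Real.sqrt q ^ n) ^ 2 by rw [← pow_mul, mul_comm, pow_mul, Real.sq_sqrt hq0.le],
        Real.sqrt_sq (pow_nonneg (Real.sqrt_nonneg _) _)]
    have hLq : c * ν ^ (3 / 2 : ℝ) / Real.sqrt (T - (T - a / q ^ n)) = L * Real.sqrt q ^ n := by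
      rw [hsq, hL]
      field_simp
    rw [hLq] at h1
    exact h1.trans h2
  have hsr : Real.sqrt q ≤ r := by
    by_contra hlt
    push Not at hlt
    have hgt : 1 < Real.sqrt q / r := (one_lt_div hr0).2 hlt
    have htop : Tendsto (fun n : ℕ => (Real.sqrt q / r) ^ n) atTop atTop := tendsto_pow_atTop_atTop_of_one_lt hgt
    obtain ⟨n, hn⟩ := (htop.eventually_gt_atTop (E₀ / L)).exists
    have h := hbound n
    have : (Real.sqrt q / r) ^ n ≤ E₀ / L := by
      rw [div_pow, div_le_div_iff₀ (pow_pos hr0 n) hL0]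
      calc Real.sqrt q ^ n * L = L * Real.sqrt q ^ n := mul_comm _ _
        _ ≤ E₀ * r ^ n := h
    linarith
  have hlog := Real.log_le_log (Real.sqrt_pos.2 hq0) hsr
  rw [Real.log_sqrt hq0.le, hr, Real.log_exp] at hlog
  linarith

/-- **THE FLOOR UNDER `(S_κ)`: `1/(2κ) ≤ C`** (`κ > 0`). From `log q ≤ 2κC(q − 1)` and `1 − 1/q ≤ log q`:
`1/q ≤ 2κC` for every `q > 1`, hence `2κC ≥ 1`. [new here — elementary] -/
theorem inv_two_mul_le_of_slab (hν : 0 < ν) (hT : 0 < T) (hmax : IsMaximalSmoothSolution ν 0 u p T)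
    (hLH : IsLerayHopfOn T ν 0 (u 0) u) (hdec : HasRapidSpatialDecay (u 0)) (haxi : IsAxisymmetric (u 0))
    {κ : ℝ} (hκ : 0 < κ)
    (hslab : ∀ ⦃t₁ t₂ Ω : ℝ⦄, 0 ≤ t₁ → t₁ < t₂ → t₂ < T → (∀ t ∈ Icc t₁ t₂, ∀ x, ‖curl (u t) x‖ ≤ Ω) →
      ∫ x, ‖curl (u t₂) x‖ ^ 2 ≤ (∫ x, ‖curl (u t₁) x‖ ^ 2) * Real.exp (κ * Ω * (t₂ - t₁)))
    {C t₀ : ℝ} (ht₀ : 0 ≤ t₀) (ht₀T : t₀ < T) (hω : ∀ t ∈ Ico t₀ T, ∀ x, (T - t) * ‖curl (u t) x‖ ≤ C) :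
    1 / (2 * κ) ≤ C := by
  set A : ℝ := 2 * κ * C with hA
  have hmain : ∀ q : ℝ, 1 < q → 1 / q ≤ A := by
    intro q hq
    have hq0 : 0 < q := by linarith
    have h1 := log_le_of_slab hν hT hmax hLH hdec haxi hslab ht₀ ht₀T hω hq
    have h2 : 1 - q⁻¹ ≤ Real.log q := Real.one_sub_inv_le_log_of_pos hq0
    have h3 : 1 - q⁻¹ = (q - 1) / q := by field_simp
    have hq1 : 0 < q - 1 := by linarith
    have h4 : (q - 1) / q ≤ A * (q - 1) := by rw [hA]; linarith [h3 ▸ h2]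
    rw [div_le_iff₀ hq0] at h4
    rw [div_le_iff₀ hq0]
    nlinarith
  have hA1 : 1 ≤ A := by
    by_contra hlt
    push Not at hlt
    have hA0 : 0 < A := by
      have h := hmain 2 (by norm_num)
      linarith
    -- `q = (1 + A)/(2A) > 1` gives `2A/(1 + A) ≤ A`, i.e. `1 ≤ A`
    have hq : 1 < (1 + A) / (2 * A) := by
      rw [lt_div_iff₀ (by positivity)]; linarith
    have h := hmain _ hq
    rw [one_div_div, div_le_iff₀ (by positivity)] at h
    nlinarith
  rw [div_le_iff₀ (by positivity)]
  linarith

/-! ### Assembled for the witnesses of the certificate class -/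

/-- **CERTIFICATE-CLASS WITNESSES OBEYING `(S_κ)` HAVE `C ≥ 1/(2κ)`.** For every `(ν, T, u, p)` of the certificate class
`CertifiedBlowupVorticityRateBlowup` — a maximal Leray–Hopf classical solution of finite lifespan `T` from a rapidly
decaying axisymmetric datum — whose enstrophy obeys the slab Grönwall `(S_κ)` on `[0, T)` with `κ > 0`, and every `C`
with `(T − t)‖curl u(t, x)‖ ≤ C` for all `x` and all `t` near `T⁻`: `1/(2κ) ≤ C`.
[cite: RobinsonRodrigoSadowski2016, Thm 12.3 (12.11)–(12.12); Leray1934, §20 (3.12)] -/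
theorem vorticityRate_witness_const_ge_of_slab (hν : 0 < ν) (hT : 0 < T)
    (hmax : IsMaximalSmoothSolution ν 0 u p T) (hLH : IsLerayHopfOn T ν 0 (u 0) u)
    (hdec : HasRapidSpatialDecay (u 0)) (haxi : IsAxisymmetric (u 0)) {κ : ℝ} (hκ : 0 < κ)
    (hslab : ∀ ⦃t₁ t₂ Ω : ℝ⦄, 0 ≤ t₁ → t₁ < t₂ → t₂ < T → (∀ t ∈ Icc t₁ t₂, ∀ x, ‖curl (u t) x‖ ≤ Ω) →
      ∫ x, ‖curl (u t₂) x‖ ^ 2 ≤ (∫ x, ‖curl (u t₁) x‖ ^ 2) * Real.exp (κ * Ω * (t₂ - t₁)))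
    {C : ℝ} (hrate : ∀ᶠ t in 𝓝[<] T, ∀ x : EuclideanSpace ℝ (Fin 3), (T - t) * ‖curl (u t) x‖ ≤ C) :
    1 / (2 * κ) ≤ C := by
  obtain ⟨l, hlT, hl⟩ := mem_nhdsLT_iff_exists_Ioo_subset.1 hrate
  have hlT' : l < T := hlT
  set t₀ : ℝ := max 0 ((l + T) / 2) with ht₀
  have ht₀0 : 0 ≤ t₀ := le_max_left _ _
  have ht₀T : t₀ < T := max_lt hT (by linarith)
  have hlt₀ : l < t₀ := lt_of_lt_of_le (by linarith) (le_max_right _ _)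
  have hω : ∀ t ∈ Ico t₀ T, ∀ x, (T - t) * ‖curl (u t) x‖ ≤ C := fun t ht =>
    hl ⟨lt_of_lt_of_le hlt₀ ht.1, ht.2⟩
  exact inv_two_mul_le_of_slab hν hT hmax hLH hdec haxi hκ hslab ht₀0 ht₀T hω

/-- **Equivalently: `limsup_{t → T⁻} (T − t)‖curl u(t)‖_∞ ≥ 1/(2κ)`** — for every witness obeying `(S_κ)`, `κ > 0`,
and every `C' < 1/(2κ)`, frequently as `t → T⁻` some point `x` has `C' < (T − t)‖curl u(t, x)‖`.
[cite: RobinsonRodrigoSadowski2016, Thm 12.3 (12.11)–(12.12); Leray1934, §20 (3.12)] -/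
theorem vorticityRate_witness_frequently_gt_of_slab (hν : 0 < ν) (hT : 0 < T)
    (hmax : IsMaximalSmoothSolution ν 0 u p T) (hLH : IsLerayHopfOn T ν 0 (u 0) u)
    (hdec : HasRapidSpatialDecay (u 0)) (haxi : IsAxisymmetric (u 0)) {κ : ℝ} (hκ : 0 < κ)
    (hslab : ∀ ⦃t₁ t₂ Ω : ℝ⦄, 0 ≤ t₁ → t₁ < t₂ → t₂ < T → (∀ t ∈ Icc t₁ t₂, ∀ x, ‖curl (u t) x‖ ≤ Ω) →
      ∫ x, ‖curl (u t₂) x‖ ^ 2 ≤ (∫ x, ‖curl (u t₁) x‖ ^ 2) * Real.exp (κ * Ω * (t₂ - t₁)))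
    {C' : ℝ} (hC' : C' < 1 / (2 * κ)) :
    ∃ᶠ t in 𝓝[<] T, ∃ x : EuclideanSpace ℝ (Fin 3), C' < (T - t) * ‖curl (u t) x‖ := by
  by_contra h
  rw [Filter.not_frequently] at h
  have h' : ∀ᶠ t in 𝓝[<] T, ∀ x : EuclideanSpace ℝ (Fin 3), (T - t) * ‖curl (u t) x‖ ≤ C' :=
    h.mono fun t ht x => not_lt.1 fun hx => ht ⟨x, hx⟩
  exact (not_le.2 hC') (vorticityRate_witness_const_ge_of_slab hν hT hmax hLH hdec haxi hκ hslab h')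

/-- **THE KILL STATEMENT BELOW THE THRESHOLD `1/(2κ)`, UNDER `(S_κ)`.** The text of crux #4
`CertifiedBlowupVorticityRateExclusion` with the slab hypothesis `(S_κ)` (`κ > 0`) added and `∀ C` restricted to
`∀ C < 1/(2κ)` (verbatim otherwise): every maximal Leray–Hopf classical solution of finite lifespan `T > 0` from a rapidly
decaying axisymmetric datum, any `ν > 0`, whose enstrophy obeys `(S_κ)`, has, for every `C < 1/(2κ)`, frequently near
`T⁻` a point with `C < (T − t)‖curl u(t, x)‖`.
[cite: RobinsonRodrigoSadowski2016, Thm 12.3 (12.11)–(12.12); Leray1934, §20 (3.12)] -/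
theorem vorticityRateExclusion_below_of_slab {κ : ℝ} (hκ : 0 < κ) : ∀ ν : ℝ, 0 < ν → ∀ T : ℝ, 0 < T →
    ∀ (u : ℝ → EuclideanSpace ℝ (Fin 3) → EuclideanSpace ℝ (Fin 3)) (p : ℝ → EuclideanSpace ℝ (Fin 3) → ℝ),
    IsMaximalSmoothSolution ν 0 u p T → IsLerayHopfOn T ν 0 (u 0) u → HasRapidSpatialDecay (u 0) →
    IsAxisymmetric (u 0) →
    (∀ ⦃t₁ t₂ Ω : ℝ⦄, 0 ≤ t₁ → t₁ < t₂ → t₂ < T → (∀ t ∈ Icc t₁ t₂, ∀ x, ‖curl (u t) x‖ ≤ Ω) →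
      ∫ x, ‖curl (u t₂) x‖ ^ 2 ≤ (∫ x, ‖curl (u t₁) x‖ ^ 2) * Real.exp (κ * Ω * (t₂ - t₁))) →
    ∀ C : ℝ, C < 1 / (2 * κ) →
    ∃ᶠ t in 𝓝[<] T, ∃ x : EuclideanSpace ℝ (Fin 3), C < (T - t) * ‖curl (u t) x‖ :=
  fun _ hν _ hT _ _ hmax hLH hdec haxi hslab _ hC =>
    vorticityRate_witness_frequently_gt_of_slab hν hT hmax hLH hdec haxi hκ hslab hC

/-! ### The instance `κ = 2` reproduces deposit 6 -/

/-- `κ = 2` (`slab_gronwall_two`) reproduces deposit 6's floor `quarter_le_of_vorticityRate` verbatim: `1/(2·2) = 1/4`.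
[cite: RobinsonRodrigoSadowski2016, Thm 12.3 (12.11)–(12.12); Leray1934, §20 (3.12)] -/
example (hν : 0 < ν) (hT : 0 < T) (hmax : IsMaximalSmoothSolution ν 0 u p T)
    (hLH : IsLerayHopfOn T ν 0 (u 0) u) (hdec : HasRapidSpatialDecay (u 0)) (haxi : IsAxisymmetric (u 0))
    {C t₀ : ℝ} (ht₀ : 0 ≤ t₀) (ht₀T : t₀ < T) (hω : ∀ t ∈ Ico t₀ T, ∀ x, (T - t) * ‖curl (u t) x‖ ≤ C) :
    1 / 4 ≤ C := by
  have hreg := hasBoundedSobolevNormsOn_before_of_lerayHopf_classical hν hT hmax.1 hLH hdec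
  have h := inv_two_mul_le_of_slab hν hT hmax hLH hdec haxi (by norm_num : (0 : ℝ) < 2)
    (slab_gronwall_two hν hmax.1 hreg) ht₀ ht₀T hω
  norm_num at h
  exact h

/-- `κ = 2` reproduces deposit 6's `vorticityRateExclusion_below_quarter` verbatim (the slab hypothesis discharged by
`slab_gronwall_two`). [cite: RobinsonRodrigoSadowski2016, Thm 12.3 (12.11)–(12.12); Leray1934, §20 (3.12)] -/
example : ∀ ν : ℝ, 0 < ν → ∀ T : ℝ, 0 < T →
    ∀ (u : ℝ → EuclideanSpace ℝ (Fin 3) → EuclideanSpace ℝ (Fin 3)) (p : ℝ → EuclideanSpace ℝ (Fin 3) → ℝ),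
    IsMaximalSmoothSolution ν 0 u p T → IsLerayHopfOn T ν 0 (u 0) u → HasRapidSpatialDecay (u 0) →
    IsAxisymmetric (u 0) → ∀ C : ℝ, C < 1 / 4 →
    ∃ᶠ t in 𝓝[<] T, ∃ x : EuclideanSpace ℝ (Fin 3), C < (T - t) * ‖curl (u t) x‖ := by
  intro ν hν T hT u p hmax hLH hdec haxi C hC
  have hreg := hasBoundedSobolevNormsOn_before_of_lerayHopf_classical hν hT hmax.1 hLH hdec
  exact vorticityRateExclusion_below_of_slab (by norm_num : (0 : ℝ) < 2) ν hν T hT u p hmax hLH hdec haxi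
    (slab_gronwall_two hν hmax.1 hreg) C (by norm_num; exact hC)

/-- Conversely deposit 6's statements ARE the `κ = 2` instance: its floor theorem closes the `κ = 2` goal by `exact`.
[cite: RobinsonRodrigoSadowski2016, Thm 12.3 (12.11)–(12.12); Leray1934, §20 (3.12)] -/
example (hν : 0 < ν) (hT : 0 < T) (hmax : IsMaximalSmoothSolution ν 0 u p T)
    (hLH : IsLerayHopfOn T ν 0 (u 0) u) (hdec : HasRapidSpatialDecay (u 0)) (haxi : IsAxisymmetric (u 0))
    {C : ℝ} (hrate : ∀ᶠ t in 𝓝[<] T, ∀ x : EuclideanSpace ℝ (Fin 3), (T - t) * ‖curl (u t) x‖ ≤ C) :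
    1 / (2 * (2 : ℝ)) ≤ C := by
  rw [show (1 : ℝ) / (2 * 2) = 1 / 4 by norm_num]
  exact vorticityRate_witness_const_ge_quarter hν hT hmax hLH hdec haxi hrate

end Summit.NavierStokesRegularity.NavierStokesRegularity.Theorems.CertifiedBlowupVorticityRateBlowup.SlabFloor

end
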